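import Mathlib
import Summits.Ventures.HodgeRepro.Tier4.Target
import Summits.Ventures.HodgeRepro.Tier4.Line3.KMDatum
import Summits.Ventures.HodgeRepro.Tier4.Line3.KMDatumS
import Summits.Ventures.HodgeRepro.Tier4.Line3.Defs

/-!
# Tier4/Line3/LocaliserS — the FILED localiser interface of LINE L3 (v0.16 … v0.24), as data in the tree

Blind re-derivation cell `pub-hodge-repro`, Tier 4 «PROVE THE STEP» (README §9–§10), LINE L3 (orbit expansion of the
quadruple theta period), seat t4-x2 (reserve wall-breaker on L3.4; filed on the INTERFACE ALERT S12539 — the tree's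
`Tier4/Line3/Localiser.lean` (p666059) carries the v0.14 `Loc` with the ONE-SIDED `InBall` support, against which
L3.4 / L3.5 are FALSE as typed at a split prime (t4-L2-p3 S12366, planner S12405, crit-1 S12419), and tree declarations
are never rewritten).

CONTENT = Skeleton v0.24 (FILED 16ccda11d70dc1fc · 1290, lead S12532) L624–L635 and L751–L801 VERBATIM, with the two
identifiers renamed `Loc → LocS`, `LocE → LocES` (the `KMDatumS` precedent, S12437); nothing else changes:

* `conjIdeal 𝔭 = c(𝔭)` (v0.16) and `gaussDefAt c₀ x` (v0.16), the two definitions the FILED `Loc` uses and the tree's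
  `Defs` (v0.14) does not have;
* `LocS` = the FILED `Loc`: `level`, `loc`, `supp` TWO-SIDED and INTEGRAL over a finite set `S` of lattices containing
  `xm` (S12393 (b)/(4)), `main_one`, `growth` WITH the definite Gaussians `gaussDefAt c₀` (S12342 (2)), `level_le` (S12270);
* `LocES` = the FILED `LocE` (`LocS` + `euler`).

The planner's next hash names `LocS` / `LocES` in L3.3 / L3.4 / L3.5 / the assembly and drops its inline copies; the
tree's `Loc` / `LocE` / `InBall` stay as declarations of record.  Nothing here asserts anything about the truth of (P);
HC_CM is NOT proved by anyone in this repository.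
-/

set_option autoImplicit false

noncomputable section

namespace Summit.Ventures.HodgeRepro.Tier4.Line3

open Summit.Ventures.HodgeRepro.Tier4
open Matrix MeasureTheory NumberField
open Filter Topology
open scoped ComplexConjugate ComplexOrder

open scoped Classical

namespace T4Data

variable (X : T4Data)


/-- The conjugate ideal `𝔭̄ = c(𝔭)` of an ideal of `𝒪_E` (the complex conjugation of the CM field restricted to the
integers).  For `𝔭` split over `E⁺`, `𝔭 𝔭̄` is the prime of `E⁺` below: the depth-`N` congruence ball at a split place
is the congruence modulo `(𝔭 𝔭̄)^N` — both halves of `V_𝔭 = F³ × F³` (v0.16). -/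
def conjIdeal (I : Ideal (NumberField.RingOfIntegers X.E)) : Ideal (NumberField.RingOfIntegers X.E) :=
  Ideal.map (NumberField.RingOfIntegers.mapRingEquiv X.c).toRingHom I

/-- The Gaussian of the DEFINITE places with a free constant `c₀` (`gaussDefAt π` is bounded by `gaussDef` up to the
positive-definiteness constants of the `H_σ`; a smaller `c₀` absorbs polynomial factors): the shape of the decay a
Hecke combination of the coefficient functions inherits uniformly in the depth (v0.16). -/
def gaussDefAt (c₀ : ℝ) (x : Fin 3 → X.E) : ℝ :=
  ∏ᶠ (σ : X.E →+* ℂ) (_ : σ ≠ X.τ₀ ∧ σ ≠ conjEmb X.τ₀), Real.exp (-(c₀ * ∑ i, ‖σ (x i)‖ ^ 2))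


/-- A **DEEP-LEVEL LOCALISER** around `xm` at the prime `𝔭` (step 3 as DATA with its defining properties): for each
depth `N` a level and a `ℂ`-combination of Hecke quadruples of that level whose quadruple coefficient function is
supported (up to the torus) in the depth-`N` congruence ball around `xm`, equals `1` at `xm`, and grows at most
polynomially in the ball coordinates, uniformly in `N` (the local torus averages of lattice indicators grow like the
content of the vector; the Gaussians of the kernel absorb polynomial growth).  Positivity of the main term is NOT a
field (the per-class coefficients carry the signs of the unramified torus sums); it is the content of L3.6. -/
structure LocS (D : X.ThetaData) (p : IsDedekindDomain.HeightOneSpectrum (NumberField.RingOfIntegers X.E))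
    (L₀ : Submodule (NumberField.RingOfIntegers X.E) (Fin 3 → X.E)) (xm : X.Tuple) where
  /-- the level at depth `N` -/
  level : ℕ → X.Level
  /-- the localising translate at depth `N` -/
  loc : ∀ N : ℕ, X.Tr (level N)
  /-- support in the depth-`N` ball, TWO-SIDED and INTEGRAL (v0.16, t4-L2-p3 S12393 (b), (4)): some representative of
  the line tuple lies in `xm + (𝔭 𝔭̄)^N L` for one of finitely many lattices `L ∋ xm` — the lattices are the adelic
  torus classes of the support (`ThetaData.support`), finitely many; the congruence is at `𝔭` AND `𝔭̄` (both halves of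
  the split place) and INTEGRAL relative to `L` (no free denominators: the Gram deviation of an off-main tuple then lies
  in `(𝔭 𝔭̄)^N 𝔞` for a FIXED finitely generated `𝒪`-module `𝔞 = Σ_L hform(L, xm) + hform(L, L)`, so it has
  archimedean size `≥ (N(𝔭)^N / C)^{1/d}` at some embedding — `ArchSize.rung_archimedean_size_of_denom`) -/
  supp : ∃ S : Finset (Submodule (NumberField.RingOfIntegers X.E) (Fin 3 → X.E)),
    (∀ L ∈ S, X.IsLattice L ∧ ∀ j, xm j ∈ L) ∧
    ∀ N (w : X.LineTuple), X.coefQ D.cf (loc N) (X.rep w) ≠ 0 → ∃ x : X.Tuple, X.lines x = w ∧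
      ∃ L ∈ S, ∀ j, x j - xm j ∈ (p.asIdeal * X.conjIdeal p.asIdeal) ^ N • L
  /-- normalisation at `xm` -/
  main_one : ∀ N, X.coefQ D.cf (loc N) xm = 1
  /-- polynomial growth in the ball coordinates WITH GAUSSIAN DECAY AT THE DEFINITE PLACES, uniformly in the depth
  (v0.16, t4-L2-p3 S12342 (2): `ThetaData.decay` is inherited by every Hecke combination — the translates are unitary
  at every `σ` — and the local torus averages of lattice indicators grow like the content, a polynomial factor that a
  `c₀ < π` absorbs; without the Gaussians L3.5's off-main sum has no majorant at the definite places) -/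
  growth : ∃ B e c₀ : ℝ, 0 < c₀ ∧ ∀ N (w : X.LineTuple),
    ‖X.coefQ D.cf (loc N) (X.rep w)‖ ≤
      B * ∏ j, ((1 + ‖X.ballCoord (X.rep w j)‖) ^ e * X.gaussDefAt c₀ (X.rep w j))
  /-- the level at depth `N` is no deeper than `Γ ∩ Γ(q₀^N)` for ONE `q₀` (v0.12, t4-L2-p3 S12270: without this a
  localiser may re-express the same Hecke combination at an arbitrarily deep auxiliary level — `coefQ` unchanged, every
  other clause inherited — and the orbital terms scale with the index of the level, so no majorant exists); the honest
  `𝔭`-adic localiser has level `Γ ∩ Γ(𝔭^N) ⊇ Γ ∩ Γ(q^N)`, `q = N(𝔭) ∈ 𝔭`, so L3.3 delivers it; under it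
  `[Γ : level N] ≤ |GL_3(𝒪/q₀^N)| ≤ q₀^{9dN}`, which the off-main Gaussian `e^{−c q^{N/d}}` beats -/
  level_le : ∃ q₀ : ℕ, 1 ≤ q₀ ∧ ∀ N, X.Γ ∩ principalCongruence X.c X.H (q₀ ^ N) ⊆ (level N).1

/-- A deep-level localiser WITH THE EULER PRODUCT (the R1 repair of L3.6, lead S12159: a clause on the localiser
describing the values of `coefQ (loc N)` on the main orbit, DELIVERED by L3.3 and CONSUMED by L3.6).  The values
themselves are NOT sign-definite for the genuine localiser (the unramified local torus averages are geometric sums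
`Σ_n μ_v(ϖ)^n`), so the clause is what the Euler product actually delivers: the CLASS SUMS `S_N = classSum (loc N) xm`
(the weighted sum of `coefQ (loc N)` over the `Γ′_N`-classes of the main orbit, II-b′) CONVERGE to a NON-ZERO limit —
`S_N → O_𝔭(loc_N φ_𝔭, xm) · ∏_{v ∉ S} 1 · ∏_{v ∈ S∖𝔭} O_v(φ_v, xm)` by strong approximation and the FACE relation on
`Stab = E′^1 × E′^1`.  A localiser satisfying only `Loc` may have main term `≡ 0` (the critics' `loc′_N = loc_N − c_N γ′_N`,
S12146); this clause is exactly what excludes it. -/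
structure LocES (D : X.ThetaData) (p : IsDedekindDomain.HeightOneSpectrum (NumberField.RingOfIntegers X.E))
    (L₀ : Submodule (NumberField.RingOfIntegers X.E) (Fin 3 → X.E)) (xm : X.Tuple) extends X.LocS D p L₀ xm where
  /-- the class sums of the main orbit converge to a non-zero limit (the Euler product) -/
  euler : ∃ κ : ℂ, κ ≠ 0 ∧ Tendsto (fun N => X.classSum D.cf (loc N) xm) atTop (𝓝 κ)

end T4Data

end Summit.Ventures.HodgeRepro.Tier4.Line3

end
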